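import Summits.MatrixMultiplication.MatrixMultiplication.Theorems.SoloBlindTriangleQuotZsf

/-!
# The triangle quotient is admissible, II: H-goodness (solo-blind s80)

Continuation of `SoloBlindTriangleQuotZsf` (same setting and notation: a triangle
`a b c q1 q2 q3` of 3-term representations of the H-good target `τ` inside the zero-sum-free `S`,
exponent 3, `K' = {n1 • h q1 + n2 • h q2 + n3 • h q3}`).  By a second table of 27 explicit
certificates, a subset `U ⊆ S` avoiding the triangle — the empty one included — never sums into
`τ + τ + K'` (`soloBlind_triangle_sum_ne_two_add_combo`); corollary
`soloBlind_triangle_quot_hgood`: modulo any additive hom whose kernel lies in `K'`, the class of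
`τ` is H-good for the outside set.  So
`(S ∖ hexad, [τ])` is an admissible configuration of the quotient group, six elements smaller — the
quotient half of the TRIANGLE MOVE (K3.23.16).
-/

namespace Summit.MatrixMultiplication.MatrixMultiplication.Theorems

open Finset

universe u

variable {ι : Type*} [DecidableEq ι]
variable {G : Type u} [AddCommGroup G]
variable {G' : Type u} [AddCommGroup G']

set_option maxHeartbeats 800000 in
/-- TRIANGLE QUOTIENT, H-goodness: a subset of `S` avoiding the triangle (possibly empty) never sums
into `τ + τ + K'` (27 explicit certificates). -/
theorem soloBlind_triangle_sum_ne_two_add_combo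
    (three : ∀ g : G, g + g + g = 0) {h : ι → G} {S : Finset ι}
    (zsf : ∀ T ⊆ S, T.Nonempty → ∑ i ∈ T, h i ≠ 0) {τ : G} (hgood : ∀ T ⊆ S, ∑ i ∈ T, h i ≠ τ + τ)
    {a b c q1 q2 q3 : ι} (ha : a ∈ S) (hb : b ∈ S) (hc : c ∈ S) (hq1 : q1 ∈ S) (hq2 : q2 ∈ S)
    (hq3 : q3 ∈ S) (d_a_b : a ≠ b) (d_a_c : a ≠ c) (d_a_q1 : a ≠ q1) (d_a_q2 : a ≠ q2)
    (d_a_q3 : a ≠ q3) (d_b_c : b ≠ c) (d_b_q1 : b ≠ q1) (d_b_q2 : b ≠ q2) (d_b_q3 : b ≠ q3)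
    (d_c_q1 : c ≠ q1) (d_c_q2 : c ≠ q2) (d_c_q3 : c ≠ q3) (d_q1_q2 : q1 ≠ q2) (d_q1_q3 : q1 ≠ q3)
    (d_q2_q3 : q2 ≠ q3)
    (hA : h a + h q1 + h q3 = τ) (hB : h b + h q1 + h q2 = τ) (hC : h c + h q2 + h q3 = τ)
    {U : Finset ι} (hUS : U ⊆ S) (haU : a ∉ U) (hbU : b ∉ U) (hcU : c ∉ U) (hq1U : q1 ∉ U)
    (hq2U : q2 ∉ U) (hq3U : q3 ∉ U)
    (n1 n2 n3 : ℕ) (hn1 : n1 < 3) (hn2 : n2 < 3) (hn3 : n3 < 3) :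
    ∑ i ∈ U, h i ≠ τ + τ + (n1 • h q1 + n2 • h q2 + n3 • h q3) := by
  have ha' : h a = τ - h q1 - h q3 := by rw [← hA]; abel
  have hb' : h b = τ - h q1 - h q2 := by rw [← hB]; abel
  have hc' : h c = τ - h q2 - h q3 := by rw [← hC]; abel
  have hins : ∀ y : ι, y ∈ S → ∀ V : Finset ι, V ⊆ S → insert y V ⊆ S :=
    fun y hy V hV => Finset.insert_subset_iff.mpr ⟨hy, hV⟩
  intro hU
  interval_cases n1 <;> interval_cases n2 <;> interval_cases n3
  · -- k = (0, 0, 0): (τ+τ)-sum on U ∪ {}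
    exact hgood (U)
      hUS
      (by rw [hU]
          exact soloBlind_tri_close three τ (h q1) (h q2) (h q3) (0) (0) (0) (0) (by
            (try simp only [zero_smul, add_zero]); abel))
  · -- k = (0, 0, 1): zero sum on U ∪ {a, q1}
    have N1 : a ∉ insert q1 U := by
      simp only [Finset.mem_insert, not_or]; exact ⟨d_a_q1, haU⟩
    exact zsf (insert a (insert q1 U))
      (hins _ ha _ (hins _ hq1 _ hUS)) (Finset.insert_nonempty _ _)
      (by rw [Finset.sum_insert N1, Finset.sum_insert hq1U, hU]
          simp only [ha']
          exact soloBlind_tri_close three τ (h q1) (h q2) (h q3) (1) (0) (0) (0) (by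
            (try simp only [zero_smul, one_smul, add_zero, zero_add]); abel))
  · -- k = (0, 0, 2): (τ+τ)-sum on U ∪ {q3}
    exact hgood (insert q3 U)
      (hins _ hq3 _ hUS)
      (by rw [Finset.sum_insert hq3U, hU]
          exact soloBlind_tri_close three τ (h q1) (h q2) (h q3) (0) (0) (0) (1) (by
            (try simp only [zero_smul, one_smul, add_zero, zero_add]); abel))
  · -- k = (0, 1, 0): zero sum on U ∪ {b, q1}
    have N1 : b ∉ insert q1 U := by
      simp only [Finset.mem_insert, not_or]; exact ⟨d_b_q1, hbU⟩
    exact zsf (insert b (insert q1 U))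
      (hins _ hb _ (hins _ hq1 _ hUS)) (Finset.insert_nonempty _ _)
      (by rw [Finset.sum_insert N1, Finset.sum_insert hq1U, hU]
          simp only [hb']
          exact soloBlind_tri_close three τ (h q1) (h q2) (h q3) (1) (0) (0) (0) (by
            (try simp only [zero_smul, one_smul, add_zero, zero_add]); abel))
  · -- k = (0, 1, 1): zero sum on U ∪ {c}
    exact zsf (insert c U)
      (hins _ hc _ hUS) (Finset.insert_nonempty _ _)
      (by rw [Finset.sum_insert hcU, hU]
          simp only [hc']
          exact soloBlind_tri_close three τ (h q1) (h q2) (h q3) (1) (0) (0) (0) (by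
            (try simp only [zero_smul, one_smul, add_zero, zero_add]); abel))
  · -- k = (0, 1, 2): zero sum on U ∪ {b, q1, q3}
    have N1 : b ∉ insert q1 (insert q3 U) := by
      simp only [Finset.mem_insert, not_or]; exact ⟨d_b_q1, d_b_q3, hbU⟩
    have N2 : q1 ∉ insert q3 U := by
      simp only [Finset.mem_insert, not_or]; exact ⟨d_q1_q3, hq1U⟩
    exact zsf (insert b (insert q1 (insert q3 U)))
      (hins _ hb _ (hins _ hq1 _ (hins _ hq3 _ hUS))) (Finset.insert_nonempty _ _)
      (by rw [Finset.sum_insert N1, Finset.sum_insert N2, Finset.sum_insert hq3U, hU]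
          simp only [hb']
          exact soloBlind_tri_close three τ (h q1) (h q2) (h q3) (1) (0) (0) (1) (by
            (try simp only [zero_smul, one_smul, add_zero, zero_add]); abel))
  · -- k = (0, 2, 0): (τ+τ)-sum on U ∪ {q2}
    exact hgood (insert q2 U)
      (hins _ hq2 _ hUS)
      (by rw [Finset.sum_insert hq2U, hU]
          exact soloBlind_tri_close three τ (h q1) (h q2) (h q3) (0) (0) (1) (0) (by
            (try simp only [zero_smul, one_smul, add_zero, zero_add]); abel))
  · -- k = (0, 2, 1): zero sum on U ∪ {a, q1, q2}
    have N1 : a ∉ insert q1 (insert q2 U) := by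
      simp only [Finset.mem_insert, not_or]; exact ⟨d_a_q1, d_a_q2, haU⟩
    have N2 : q1 ∉ insert q2 U := by
      simp only [Finset.mem_insert, not_or]; exact ⟨d_q1_q2, hq1U⟩
    exact zsf (insert a (insert q1 (insert q2 U)))
      (hins _ ha _ (hins _ hq1 _ (hins _ hq2 _ hUS))) (Finset.insert_nonempty _ _)
      (by rw [Finset.sum_insert N1, Finset.sum_insert N2, Finset.sum_insert hq2U, hU]
          simp only [ha']
          exact soloBlind_tri_close three τ (h q1) (h q2) (h q3) (1) (0) (1) (0) (by
            (try simp only [zero_smul, one_smul, add_zero, zero_add]); abel))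
  · -- k = (0, 2, 2): (τ+τ)-sum on U ∪ {q2, q3}
    have N1 : q2 ∉ insert q3 U := by
      simp only [Finset.mem_insert, not_or]; exact ⟨d_q2_q3, hq2U⟩
    exact hgood (insert q2 (insert q3 U))
      (hins _ hq2 _ (hins _ hq3 _ hUS))
      (by rw [Finset.sum_insert N1, Finset.sum_insert hq3U, hU]
          exact soloBlind_tri_close three τ (h q1) (h q2) (h q3) (0) (0) (1) (1) (by
            (try simp only [zero_smul, one_smul, add_zero, zero_add]); abel))
  · -- k = (1, 0, 0): zero sum on U ∪ {a, q3}
    have N1 : a ∉ insert q3 U := by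
      simp only [Finset.mem_insert, not_or]; exact ⟨d_a_q3, haU⟩
    exact zsf (insert a (insert q3 U))
      (hins _ ha _ (hins _ hq3 _ hUS)) (Finset.insert_nonempty _ _)
      (by rw [Finset.sum_insert N1, Finset.sum_insert hq3U, hU]
          simp only [ha']
          exact soloBlind_tri_close three τ (h q1) (h q2) (h q3) (1) (0) (0) (0) (by
            (try simp only [zero_smul, one_smul, add_zero]); abel))
  · -- k = (1, 0, 1): zero sum on U ∪ {a}
    exact zsf (insert a U)
      (hins _ ha _ hUS) (Finset.insert_nonempty _ _)
      (by rw [Finset.sum_insert haU, hU]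
          simp only [ha']
          exact soloBlind_tri_close three τ (h q1) (h q2) (h q3) (1) (0) (0) (0) (by
            (try simp only [zero_smul, one_smul, add_zero]); abel))
  · -- k = (1, 0, 2): zero sum on U ∪ {b, q2, q3}
    have N1 : b ∉ insert q2 (insert q3 U) := by
      simp only [Finset.mem_insert, not_or]; exact ⟨d_b_q2, d_b_q3, hbU⟩
    have N2 : q2 ∉ insert q3 U := by
      simp only [Finset.mem_insert, not_or]; exact ⟨d_q2_q3, hq2U⟩
    exact zsf (insert b (insert q2 (insert q3 U)))
      (hins _ hb _ (hins _ hq2 _ (hins _ hq3 _ hUS))) (Finset.insert_nonempty _ _)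
      (by rw [Finset.sum_insert N1, Finset.sum_insert N2, Finset.sum_insert hq3U, hU]
          simp only [hb']
          exact soloBlind_tri_close three τ (h q1) (h q2) (h q3) (1) (0) (0) (1) (by
            (try simp only [zero_smul, one_smul, add_zero]); abel))
  · -- k = (1, 1, 0): zero sum on U ∪ {b}
    exact zsf (insert b U)
      (hins _ hb _ hUS) (Finset.insert_nonempty _ _)
      (by rw [Finset.sum_insert hbU, hU]
          simp only [hb']
          exact soloBlind_tri_close three τ (h q1) (h q2) (h q3) (1) (0) (0) (0) (by
            (try simp only [zero_smul, one_smul, add_zero]); abel))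
  · -- k = (1, 1, 1): (τ+τ)-sum on U ∪ {a, b, c, q1, q2, q3}
    have N1 : a ∉ insert b (insert c (insert q1 (insert q2 (insert q3 U)))) := by
      simp only [Finset.mem_insert, not_or]; exact ⟨d_a_b, d_a_c, d_a_q1, d_a_q2, d_a_q3, haU⟩
    have N2 : b ∉ insert c (insert q1 (insert q2 (insert q3 U))) := by
      simp only [Finset.mem_insert, not_or]; exact ⟨d_b_c, d_b_q1, d_b_q2, d_b_q3, hbU⟩
    have N3 : c ∉ insert q1 (insert q2 (insert q3 U)) := by
      simp only [Finset.mem_insert, not_or]; exact ⟨d_c_q1, d_c_q2, d_c_q3, hcU⟩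
    have N4 : q1 ∉ insert q2 (insert q3 U) := by
      simp only [Finset.mem_insert, not_or]; exact ⟨d_q1_q2, d_q1_q3, hq1U⟩
    have N5 : q2 ∉ insert q3 U := by
      simp only [Finset.mem_insert, not_or]; exact ⟨d_q2_q3, hq2U⟩
    exact hgood (insert a (insert b (insert c (insert q1 (insert q2 (insert q3 U))))))
      (hins _ ha _ (hins _ hb _ (hins _ hc _ (hins _ hq1 _ (hins _ hq2 _ (hins _ hq3 _ hUS))))))
      (by rw [Finset.sum_insert N1, Finset.sum_insert N2, Finset.sum_insert N3,
            Finset.sum_insert N4, Finset.sum_insert N5, Finset.sum_insert hq3U, hU]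
          simp only [ha', hb', hc']
          exact soloBlind_tri_close three τ (h q1) (h q2) (h q3) (1) (0) (0) (0) (by
            (try simp only [zero_smul, one_smul, add_zero]); abel))
  · -- k = (1, 1, 2): zero sum on U ∪ {b, q3}
    have N1 : b ∉ insert q3 U := by
      simp only [Finset.mem_insert, not_or]; exact ⟨d_b_q3, hbU⟩
    exact zsf (insert b (insert q3 U))
      (hins _ hb _ (hins _ hq3 _ hUS)) (Finset.insert_nonempty _ _)
      (by rw [Finset.sum_insert N1, Finset.sum_insert hq3U, hU]
          simp only [hb']
          exact soloBlind_tri_close three τ (h q1) (h q2) (h q3) (1) (0) (0) (1) (by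
            (try simp only [zero_smul, one_smul, add_zero]); abel))
  · -- k = (1, 2, 0): zero sum on U ∪ {a, q2, q3}
    have N1 : a ∉ insert q2 (insert q3 U) := by
      simp only [Finset.mem_insert, not_or]; exact ⟨d_a_q2, d_a_q3, haU⟩
    have N2 : q2 ∉ insert q3 U := by
      simp only [Finset.mem_insert, not_or]; exact ⟨d_q2_q3, hq2U⟩
    exact zsf (insert a (insert q2 (insert q3 U)))
      (hins _ ha _ (hins _ hq2 _ (hins _ hq3 _ hUS))) (Finset.insert_nonempty _ _)
      (by rw [Finset.sum_insert N1, Finset.sum_insert N2, Finset.sum_insert hq3U, hU]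
          simp only [ha']
          exact soloBlind_tri_close three τ (h q1) (h q2) (h q3) (1) (0) (1) (0) (by
            (try simp only [zero_smul, one_smul, add_zero]); abel))
  · -- k = (1, 2, 1): zero sum on U ∪ {a, q2}
    have N1 : a ∉ insert q2 U := by
      simp only [Finset.mem_insert, not_or]; exact ⟨d_a_q2, haU⟩
    exact zsf (insert a (insert q2 U))
      (hins _ ha _ (hins _ hq2 _ hUS)) (Finset.insert_nonempty _ _)
      (by rw [Finset.sum_insert N1, Finset.sum_insert hq2U, hU]
          simp only [ha']
          exact soloBlind_tri_close three τ (h q1) (h q2) (h q3) (1) (0) (1) (0) (by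
            (try simp only [zero_smul, one_smul, add_zero]); abel))
  · -- k = (1, 2, 2): (τ+τ)-sum on U ∪ {a, b, c, q1}
    have N1 : a ∉ insert b (insert c (insert q1 U)) := by
      simp only [Finset.mem_insert, not_or]; exact ⟨d_a_b, d_a_c, d_a_q1, haU⟩
    have N2 : b ∉ insert c (insert q1 U) := by
      simp only [Finset.mem_insert, not_or]; exact ⟨d_b_c, d_b_q1, hbU⟩
    have N3 : c ∉ insert q1 U := by
      simp only [Finset.mem_insert, not_or]; exact ⟨d_c_q1, hcU⟩
    exact hgood (insert a (insert b (insert c (insert q1 U))))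
      (hins _ ha _ (hins _ hb _ (hins _ hc _ (hins _ hq1 _ hUS))))
      (by rw [Finset.sum_insert N1, Finset.sum_insert N2,
            Finset.sum_insert N3, Finset.sum_insert hq1U, hU]
          simp only [ha', hb', hc']
          exact soloBlind_tri_close three τ (h q1) (h q2) (h q3) (1) (0) (0) (0) (by
            (try simp only [zero_smul, one_smul, add_zero]); abel))
  · -- k = (2, 0, 0): (τ+τ)-sum on U ∪ {q1}
    exact hgood (insert q1 U)
      (hins _ hq1 _ hUS)
      (by rw [Finset.sum_insert hq1U, hU]
          exact soloBlind_tri_close three τ (h q1) (h q2) (h q3) (0) (1) (0) (0) (by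
            (try simp only [zero_smul, one_smul, add_zero, zero_add]); abel))
  · -- k = (2, 0, 1): zero sum on U ∪ {c, q1, q2}
    have N1 : c ∉ insert q1 (insert q2 U) := by
      simp only [Finset.mem_insert, not_or]; exact ⟨d_c_q1, d_c_q2, hcU⟩
    have N2 : q1 ∉ insert q2 U := by
      simp only [Finset.mem_insert, not_or]; exact ⟨d_q1_q2, hq1U⟩
    exact zsf (insert c (insert q1 (insert q2 U)))
      (hins _ hc _ (hins _ hq1 _ (hins _ hq2 _ hUS))) (Finset.insert_nonempty _ _)
      (by rw [Finset.sum_insert N1, Finset.sum_insert N2, Finset.sum_insert hq2U, hU]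
          simp only [hc']
          exact soloBlind_tri_close three τ (h q1) (h q2) (h q3) (1) (1) (0) (0) (by
            (try simp only [zero_smul, one_smul, add_zero]); abel))
  · -- k = (2, 0, 2): (τ+τ)-sum on U ∪ {q1, q3}
    have N1 : q1 ∉ insert q3 U := by
      simp only [Finset.mem_insert, not_or]; exact ⟨d_q1_q3, hq1U⟩
    exact hgood (insert q1 (insert q3 U))
      (hins _ hq1 _ (hins _ hq3 _ hUS))
      (by rw [Finset.sum_insert N1, Finset.sum_insert hq3U, hU]
          exact soloBlind_tri_close three τ (h q1) (h q2) (h q3) (0) (1) (0) (1) (by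
            (try simp only [zero_smul, one_smul, add_zero, zero_add]); abel))
  · -- k = (2, 1, 0): zero sum on U ∪ {c, q1, q3}
    have N1 : c ∉ insert q1 (insert q3 U) := by
      simp only [Finset.mem_insert, not_or]; exact ⟨d_c_q1, d_c_q3, hcU⟩
    have N2 : q1 ∉ insert q3 U := by
      simp only [Finset.mem_insert, not_or]; exact ⟨d_q1_q3, hq1U⟩
    exact zsf (insert c (insert q1 (insert q3 U)))
      (hins _ hc _ (hins _ hq1 _ (hins _ hq3 _ hUS))) (Finset.insert_nonempty _ _)
      (by rw [Finset.sum_insert N1, Finset.sum_insert N2, Finset.sum_insert hq3U, hU]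
          simp only [hc']
          exact soloBlind_tri_close three τ (h q1) (h q2) (h q3) (1) (1) (0) (0) (by
            (try simp only [zero_smul, one_smul, add_zero]); abel))
  · -- k = (2, 1, 1): zero sum on U ∪ {c, q1}
    have N1 : c ∉ insert q1 U := by
      simp only [Finset.mem_insert, not_or]; exact ⟨d_c_q1, hcU⟩
    exact zsf (insert c (insert q1 U))
      (hins _ hc _ (hins _ hq1 _ hUS)) (Finset.insert_nonempty _ _)
      (by rw [Finset.sum_insert N1, Finset.sum_insert hq1U, hU]
          simp only [hc']
          exact soloBlind_tri_close three τ (h q1) (h q2) (h q3) (1) (1) (0) (0) (by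
            (try simp only [zero_smul, one_smul, add_zero]); abel))
  · -- k = (2, 1, 2): (τ+τ)-sum on U ∪ {a, b, c, q2}
    have N1 : a ∉ insert b (insert c (insert q2 U)) := by
      simp only [Finset.mem_insert, not_or]; exact ⟨d_a_b, d_a_c, d_a_q2, haU⟩
    have N2 : b ∉ insert c (insert q2 U) := by
      simp only [Finset.mem_insert, not_or]; exact ⟨d_b_c, d_b_q2, hbU⟩
    have N3 : c ∉ insert q2 U := by
      simp only [Finset.mem_insert, not_or]; exact ⟨d_c_q2, hcU⟩
    exact hgood (insert a (insert b (insert c (insert q2 U))))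
      (hins _ ha _ (hins _ hb _ (hins _ hc _ (hins _ hq2 _ hUS))))
      (by rw [Finset.sum_insert N1, Finset.sum_insert N2,
            Finset.sum_insert N3, Finset.sum_insert hq2U, hU]
          simp only [ha', hb', hc']
          exact soloBlind_tri_close three τ (h q1) (h q2) (h q3) (1) (0) (0) (0) (by
            (try simp only [zero_smul, one_smul, add_zero]); abel))
  · -- k = (2, 2, 0): (τ+τ)-sum on U ∪ {q1, q2}
    have N1 : q1 ∉ insert q2 U := by
      simp only [Finset.mem_insert, not_or]; exact ⟨d_q1_q2, hq1U⟩
    exact hgood (insert q1 (insert q2 U))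
      (hins _ hq1 _ (hins _ hq2 _ hUS))
      (by rw [Finset.sum_insert N1, Finset.sum_insert hq2U, hU]
          exact soloBlind_tri_close three τ (h q1) (h q2) (h q3) (0) (1) (1) (0) (by
            (try simp only [zero_smul, one_smul, add_zero, zero_add]); abel))
  · -- k = (2, 2, 1): (τ+τ)-sum on U ∪ {a, b, c, q3}
    have N1 : a ∉ insert b (insert c (insert q3 U)) := by
      simp only [Finset.mem_insert, not_or]; exact ⟨d_a_b, d_a_c, d_a_q3, haU⟩
    have N2 : b ∉ insert c (insert q3 U) := by
      simp only [Finset.mem_insert, not_or]; exact ⟨d_b_c, d_b_q3, hbU⟩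
    have N3 : c ∉ insert q3 U := by
      simp only [Finset.mem_insert, not_or]; exact ⟨d_c_q3, hcU⟩
    exact hgood (insert a (insert b (insert c (insert q3 U))))
      (hins _ ha _ (hins _ hb _ (hins _ hc _ (hins _ hq3 _ hUS))))
      (by rw [Finset.sum_insert N1, Finset.sum_insert N2,
            Finset.sum_insert N3, Finset.sum_insert hq3U, hU]
          simp only [ha', hb', hc']
          exact soloBlind_tri_close three τ (h q1) (h q2) (h q3) (1) (0) (0) (0) (by
            (try simp only [zero_smul, one_smul, add_zero]); abel))
  · -- k = (2, 2, 2): (τ+τ)-sum on U ∪ {a, b, c}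
    have N1 : a ∉ insert b (insert c U) := by
      simp only [Finset.mem_insert, not_or]; exact ⟨d_a_b, d_a_c, haU⟩
    have N2 : b ∉ insert c U := by
      simp only [Finset.mem_insert, not_or]; exact ⟨d_b_c, hbU⟩
    exact hgood (insert a (insert b (insert c U)))
      (hins _ ha _ (hins _ hb _ (hins _ hc _ hUS)))
      (by rw [Finset.sum_insert N1, Finset.sum_insert N2, Finset.sum_insert hcU, hU]
          simp only [ha', hb', hc']
          exact soloBlind_tri_close three τ (h q1) (h q2) (h q3) (1) (0) (0) (0) (by
            (try simp only [zero_smul, one_smul, add_zero]); abel))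

/-- TRIANGLE MOVE, quotient side (ii): modulo any hom `π` whose kernel lies in `K'`, the class of
`τ` is H-good for the outside set `S \ hexad` (the empty subset included). -/
theorem soloBlind_triangle_quot_hgood (three : ∀ g : G, g + g + g = 0) {h : ι → G} {S : Finset ι}
    (zsf : ∀ T ⊆ S, T.Nonempty → ∑ i ∈ T, h i ≠ 0) {τ : G} (hgood : ∀ T ⊆ S, ∑ i ∈ T, h i ≠ τ + τ)
    {a b c q1 q2 q3 : ι} (ha : a ∈ S) (hb : b ∈ S) (hc : c ∈ S) (hq1 : q1 ∈ S) (hq2 : q2 ∈ S)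
    (hq3 : q3 ∈ S) (d_a_b : a ≠ b) (d_a_c : a ≠ c) (d_a_q1 : a ≠ q1) (d_a_q2 : a ≠ q2)
    (d_a_q3 : a ≠ q3) (d_b_c : b ≠ c) (d_b_q1 : b ≠ q1) (d_b_q2 : b ≠ q2) (d_b_q3 : b ≠ q3)
    (d_c_q1 : c ≠ q1) (d_c_q2 : c ≠ q2) (d_c_q3 : c ≠ q3) (d_q1_q2 : q1 ≠ q2) (d_q1_q3 : q1 ≠ q3)
    (d_q2_q3 : q2 ≠ q3)
    (hA : h a + h q1 + h q3 = τ) (hB : h b + h q1 + h q2 = τ) (hC : h c + h q2 + h q3 = τ)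
    (π : G →+ G')
    (hker : ∀ g : G, π g = 0 → ∃ n1 n2 n3 : ℕ, n1 < 3 ∧ n2 < 3 ∧ n3 < 3 ∧
      g = n1 • h q1 + n2 • h q2 + n3 • h q3) :
    ∀ T ⊆ S \ soloBlindHexad a b c q1 q2 q3, ∑ i ∈ T, π (h i) ≠ π τ + π τ := by
  intro T hT hsum
  have hTS : T ⊆ S := fun i hi => (Finset.mem_sdiff.mp (hT hi)).1
  have hout : ∀ z ∈ soloBlindHexad a b c q1 q2 q3, z ∉ T := fun z hz hzT =>
    (Finset.mem_sdiff.mp (hT hzT)).2 hz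
  have hπ : π (∑ i ∈ T, h i - (τ + τ)) = 0 := by
    rw [map_sub, map_add, map_sum, hsum]; abel
  obtain ⟨n1, n2, n3, hn1, hn2, hn3, hk⟩ := hker _ hπ
  have hk' : ∑ i ∈ T, h i = τ + τ + (n1 • h q1 + n2 • h q2 + n3 • h q3) := by
    rw [← hk]; abel
  exact soloBlind_triangle_sum_ne_two_add_combo
    three zsf hgood ha hb hc hq1 hq2 hq3 d_a_b d_a_c d_a_q1 d_a_q2
    d_a_q3 d_b_c d_b_q1 d_b_q2 d_b_q3 d_c_q1 d_c_q2 d_c_q3 d_q1_q2 d_q1_q3 d_q2_q3 hA hB hC hTS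
    (hout a (by simp [soloBlindHexad])) (hout b (by simp [soloBlindHexad]))
    (hout c (by simp [soloBlindHexad])) (hout q1 (by simp [soloBlindHexad]))
    (hout q2 (by simp [soloBlindHexad])) (hout q3 (by simp [soloBlindHexad])) n1 n2 n3 hn1 hn2
    hn3 hk'

end Summit.MatrixMultiplication.MatrixMultiplication.Theorems
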